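import Literature.AlgebraicGeometry.Resolution.AdicOrderBasics
import Literature.AlgebraicGeometry.Resolution.RegularLocalRingsQuotient
import Summits.ResolutionOfSingularities.ResolutionOfSingularities.Theorems.WeightedInvariantContactCentreFiltrationBasic
import HarnessLib

/-!
# Contact levels modulo a contact parameter: the quotient method for `Reaches` / `b_max` (tools for the specimens «E8», «E2»)

Topic: `Summits/ResolutionOfSingularities/ResolutionOfSingularities/Theorems`. Helper for the door item
`HypersurfaceCentreConstruction` (statement `stmt-ResolutionOfSingularities-19897`, route `WeightedInvariant`), line
`local-engine` of res-L1-w43-plan-1 (L W4.3), regime P3 (positions of Krull dimension `3`): the GENERIC TOOLS behind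
the kernel certificates of the IOTA3 design rows «E8» (`z² + y³ + x⁷`, planner's DESIGN NOTE, DEALS gen 10 #3 (2),
2026-08-27T10:36:47Z) and «E2» (`x³ + y⁴z⁴ + y⁷`, res-type-078's `IOTA3-INPUT.md` row (E2)); the specimen files
(`…ContactLevelE2`, …) evaluate res-type-092's `Reaches` / `bMax` (`…ContactCentreFiltration`, ORDER (o24-D)) on explicit
elements with these tools.

[OURS · L1 W4.3] Replaces the role of NO printed item; NOT a statement of the manuscript
[claim: Hironaka2017, status: under-review]. AI work, weaker than expert review.

## Method (no graded rings)

To show that a level `n` of the contact filtration `contactFiltration g b n = ⨆ⱼ (gʲ)·𝔪^{n-bj}` of a contact parameter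
`g ∈ 𝔪 ∖ 𝔪²` does NOT contain an element `f`, read `f` in the quotient `S/(g)`: the level maps into `𝔪̄ⁿ`
(`ContactFiltration.le_span_sup_pow`: `contactFiltration g b n ≤ (g) + 𝔪ⁿ`), `S/(g)` is a regular local ring of dimension
`dim S - 1` (Matsumura 14.2, the tree's `IsRegularLocalRing.quotient_span_singleton`), its maximal ideal is generated by the
images of the regular parameters of `S` with ONE redundancy, and Nakayama decides which images stay regular parameters;
the order of the image is then computed with the valuation property of `adicOrder` (`adicOrder_pow`,
`adicOrder_add_eq_left_of_lt`).

## Content (namespace `ContactLevel`)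

* `span_eq_maximalIdeal_of_le_sup_sq`, `ringKrullDim_le_ncard_of_span_eq`, `not_mem_sq_of_span_insert_eq`,
  `not_mem_sq_of_span_singleton_eq`, `span_pair_eq_of_mem_sq`, `ringKrullDim_eq_of_add_one_eq` — Nakayama / Krull
  bookkeeping in a Noetherian local ring: `𝔪 = (c, s)` with `#s < dim` forces `c ∉ 𝔪²`; `𝔪 = (a, b, c)` with `c ∈ 𝔪²`
  gives `𝔪 = (a, b)`.
* `mk_mem_pow_of_mem_contactFiltration`, `maximalIdeal_quotient_eq_span₃`, `maximalIdeal_quotient_eq_span₂`,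
  `mk_mem_pow_of_mem_pow` — the passage to `S/(g)`.
* `adicOrder_pow_of_not_mem_sq`, `pow_not_mem_pow_succ_of_not_mem_sq` — `ord cᵏ = k` / `cᵏ ∉ 𝔪ᵏ⁺¹` for a regular
  parameter `c` of a regular local ring.

## References

* H. Matsumura, *Commutative Ring Theory* (1986), Thm. 14.2 (quotients of regular local rings by regular parameters),
  Thm. 13.4 (Krull: `dim ≤` number of generators of `𝔪`). [Matsumura1987]
* O. Zariski, P. Samuel, *Commutative Algebra* II, Ch. VIII §1 (the order function of a regular local ring).
  [ZariskiSamuel1960]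
* res-L1-w43-plan-1, DEALS gen 10 #3 (2) «E8»; res-type-078 `plan/tools/res-type-078/p3/IOTA3-INPUT.md` row (E2)
  (OURS, AI planning / hand computations).
-/

noncomputable section

open IsLocalRing Literature.AlgebraicGeometry.Resolution
open Summit.ResolutionOfSingularities.ResolutionOfSingularities.Cruxes.HypersurfaceCentreConstruction.LocalEngine

set_option linter.dupNamespace false -- mandated namespace of this single-conjunct summit

namespace Summit.ResolutionOfSingularities.ResolutionOfSingularities.Theorems.ContactLevel

universe u

/-! ## Nakayama bookkeeping: redundant and irredundant generators of `𝔪` -/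

section Nakayama

variable {T : Type u} [CommRing T] [IsLocalRing T] [IsNoetherianRing T]

/-- Nakayama: if `(s) ⊆ 𝔪 ⊆ (s) + 𝔪²` then `(s) = 𝔪`. [folklore] -/
theorem span_eq_maximalIdeal_of_le_sup_sq {s : Set T} (hs : Ideal.span s ≤ maximalIdeal T)
    (h : maximalIdeal T ≤ Ideal.span s ⊔ maximalIdeal T ^ 2) : Ideal.span s = maximalIdeal T := by
  refine le_antisymm hs ?_
  refine Submodule.le_of_le_smul_of_le_jacobson_bot (I := maximalIdeal T) (N := Ideal.span s)
    (N' := maximalIdeal T) (IsNoetherian.noetherian _) (IsLocalRing.maximalIdeal_le_jacobson _) ?_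
  rwa [Ideal.smul_eq_mul, ← pow_two]

/-- `dim T ≤ #s` whenever the finite set `s` generates `𝔪` (Krull). [cite: Matsumura1987, Thm. 13.4] -/
theorem ringKrullDim_le_ncard_of_span_eq {s : Set T} (hs : s.Finite) (h : Ideal.span s = maximalIdeal T) :
    ringKrullDim T ≤ (s.ncard : ℕ) := by
  refine le_trans (ringKrullDim_le_spanFinrank_maximalIdeal T) ?_
  rw [← h]
  exact_mod_cast Submodule.spanFinrank_span_le_ncard_of_finite hs

/-- **An irredundant generator of `𝔪` is a regular parameter candidate**: if `𝔪 = (c, s)` with `s` finite and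
`#s < dim T`, then `c ∉ 𝔪²` (otherwise Nakayama gives `𝔪 = (s)` and Krull gives `dim T ≤ #s`). [folklore] -/
theorem not_mem_sq_of_span_insert_eq {c : T} {s : Set T} (hs : s.Finite)
    (h : Ideal.span (insert c s) = maximalIdeal T) (hd : ((s.ncard : ℕ) : WithBot ℕ∞) < ringKrullDim T) :
    c ∉ maximalIdeal T ^ 2 := by
  intro hc
  have hs𝔪 : Ideal.span s ≤ maximalIdeal T :=
    le_trans (Ideal.span_mono (Set.subset_insert c s)) h.le
  have h𝔪 : maximalIdeal T ≤ Ideal.span s ⊔ maximalIdeal T ^ 2 := by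
    rw [← h, Ideal.span_le]
    rintro t (rfl | ht)
    · rw [h]
      exact Ideal.mem_sup_right hc
    · exact Ideal.mem_sup_left (Ideal.subset_span ht)
  have := ringKrullDim_le_ncard_of_span_eq hs (span_eq_maximalIdeal_of_le_sup_sq hs𝔪 h𝔪)
  exact absurd hd (not_lt.mpr this)

/-- One generator: if `𝔪 = (a)` and `dim T > 0` then `a ∉ 𝔪²`. [folklore] -/
theorem not_mem_sq_of_span_singleton_eq {a : T} (h : Ideal.span {a} = maximalIdeal T) (hd : 0 < ringKrullDim T) :
    a ∉ maximalIdeal T ^ 2 := by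
  refine not_mem_sq_of_span_insert_eq (s := ∅) Set.finite_empty (by rwa [← Set.singleton_def]) ?_
  rw [Set.ncard_empty]
  exact_mod_cast hd

/-- If `𝔪 = (a, b, c)` and `c ∈ 𝔪²`, then already `𝔪 = (a, b)` (Nakayama). [folklore] -/
theorem span_pair_eq_of_mem_sq {a b c : T} (h : Ideal.span {a, b, c} = maximalIdeal T) (hc : c ∈ maximalIdeal T ^ 2) :
    Ideal.span {a, b} = maximalIdeal T := by
  refine span_eq_maximalIdeal_of_le_sup_sq ?_ ?_
  · refine le_trans (Ideal.span_mono ?_) h.le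
    intro t ht
    rcases ht with rfl | rfl
    · exact Or.inl rfl
    · exact Or.inr (Or.inl rfl)
  · rw [← h, Ideal.span_le]
    rintro t (rfl | rfl | rfl)
    · exact Ideal.mem_sup_left (Ideal.subset_span (Or.inl rfl))
    · exact Ideal.mem_sup_left (Ideal.subset_span (Or.inr rfl))
    · rw [h]
      exact Ideal.mem_sup_right hc

/-- The Krull dimension of a Noetherian local ring from `dim T + 1 = d + 1`. [folklore] -/
theorem ringKrullDim_eq_of_add_one_eq {d : ℕ} (h : ringKrullDim T + 1 = ((d + 1 : ℕ) : WithBot ℕ∞)) :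
    ringKrullDim T = (d : ℕ) := by
  obtain ⟨n, hn⟩ := exists_nat_cast_eq_ringKrullDim (R := T)
  rw [hn] at h ⊢
  have : n + 1 = d + 1 := by exact_mod_cast h
  have hnd : n = d := by omega
  rw [hnd]

end Nakayama

/-! ## The contact filtration modulo its own contact parameter -/

section Quotient

variable {S : Type u} [CommRing S] [IsLocalRing S]

/-- **Level `n` of the contact filtration of `g` maps into `𝔪̄ⁿ` in `S/(g)`**: `contactFiltration g b n ≤ (g) + 𝔪ⁿ`
(`ContactFiltration.le_span_sup_pow`) and `(g)` dies in the quotient. [folklore] -/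
theorem mk_mem_pow_of_mem_contactFiltration {g : S} [IsLocalRing (S ⧸ Ideal.span {g})] {f : S} {b n : ℕ}
    (hf : f ∈ contactFiltration g b n) :
    Ideal.Quotient.mk (Ideal.span {g}) f ∈ maximalIdeal (S ⧸ Ideal.span {g}) ^ n := by
  rw [contactFiltration_def] at hf
  have hf' := ContactFiltration.le_span_sup_pow g b n hf
  obtain ⟨a, ha, m, hm, rfl⟩ := Submodule.mem_sup.mp hf'
  rw [map_add, (Ideal.Quotient.eq_zero_iff_mem).mpr ha, zero_add, maximalIdeal_quotient_eq_map (Ideal.span {g}),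
    ← Ideal.map_pow]
  exact Ideal.mem_map_of_mem _ hm

/-- The maximal ideal of `S/(g)` is generated by the images of the generators of `𝔪`. [folklore] -/
theorem maximalIdeal_quotient_eq_span₃ {g x y z : S} [IsLocalRing (S ⧸ Ideal.span {g})]
    (h𝔪 : Ideal.span {x, y, z} = maximalIdeal S) :
    Ideal.span {Ideal.Quotient.mk (Ideal.span {g}) x, Ideal.Quotient.mk (Ideal.span {g}) y,
      Ideal.Quotient.mk (Ideal.span {g}) z} = maximalIdeal (S ⧸ Ideal.span {g}) := by
  rw [maximalIdeal_quotient_eq_map (Ideal.span {g}), ← h𝔪, Ideal.map_span, Set.image_insert_eq, Set.image_insert_eq,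
    Set.image_singleton]

/-- Same with two generators. [folklore] -/
theorem maximalIdeal_quotient_eq_span₂ {g a b : S} [IsLocalRing (S ⧸ Ideal.span {g})]
    (h𝔪 : Ideal.span {a, b} = maximalIdeal S) :
    Ideal.span {Ideal.Quotient.mk (Ideal.span {g}) a, Ideal.Quotient.mk (Ideal.span {g}) b} =
      maximalIdeal (S ⧸ Ideal.span {g}) := by
  rw [maximalIdeal_quotient_eq_map (Ideal.span {g}), ← h𝔪, Ideal.map_span, Set.image_insert_eq, Set.image_singleton]

/-- `𝔪ᵏ` maps into `𝔪̄ᵏ`. [folklore] -/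
theorem mk_mem_pow_of_mem_pow {I : Ideal S} [IsLocalRing (S ⧸ I)] {c : S} {k : ℕ} (hc : c ∈ maximalIdeal S ^ k) :
    Ideal.Quotient.mk I c ∈ maximalIdeal (S ⧸ I) ^ k := by
  rw [maximalIdeal_quotient_eq_map I, ← Ideal.map_pow]
  exact Ideal.mem_map_of_mem _ hc

end Quotient

/-! ## Orders of powers of regular parameters -/

section Orders

variable {T : Type u} [CommRing T] [IsRegularLocalRing T]

/-- `ord (cᵏ) = k` for `c ∈ 𝔪 ∖ 𝔪²` in a regular local ring. [cite: Matsumura1987, Thm. 14.2] -/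
theorem adicOrder_pow_of_not_mem_sq {c : T} (hc : c ∈ maximalIdeal T) (hc2 : c ∉ maximalIdeal T ^ 2) (k : ℕ) :
    adicOrder (c ^ k) = (k : ℕ∞) := by
  rw [adicOrder_pow, (adicOrder_eq_one_iff c).mpr ⟨hc, hc2⟩, mul_one]

/-- Membership form: a regular parameter `c ∈ 𝔪 ∖ 𝔪²` has `cᵏ ∉ 𝔪ᵏ⁺¹` (`ContactFiltration.pow_not_mem_pow_of_not_mem_pow`
with `t = 1`). [cite: ZariskiSamuel1960, Ch. VIII §1] -/
theorem pow_not_mem_pow_succ_of_not_mem_sq {c : T} (hc2 : c ∉ maximalIdeal T ^ 2) (k : ℕ) :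
    c ^ k ∉ maximalIdeal T ^ (k + 1) := by
  have h := ContactFiltration.pow_not_mem_pow_of_not_mem_pow (t := 1) hc2 k
  rwa [mul_one] at h

end Orders


end Summit.ResolutionOfSingularities.ResolutionOfSingularities.Theorems.ContactLevel
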